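import Literature.Barriers.Parity.SiegelZeroDichotomyChowlaStep1
import Literature.NumberTheory.LFunctions.SiegelZeroExceptionalPrimesSecond
import HarnessLib

/-!
# Step (i) of Tao–Teräväinen at `k = 0`: Proposition 4.2 — DISCHARGED

Topic `Literature/Barriers/Parity`; a file of the proof DAG of
`Literature.Barriers.Parity.TaoTeravainen2021_chowla` (Tao–Teräväinen 2022, Corollary 1.8 (ii);
see `SiegelZeroDichotomyChowla.lean`). The named fact `TaoTeravainen2021_prop42_k0`
(Proposition 4.2 at `k = 0`: `𝔼_{n ≤ x} ∏ⱼ λ(n+hⱼ) = 𝔼_{n ≤ x} ∏ⱼ λ_Siegel(n+hⱼ) + O(log^{-1/10} η)`)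
was reduced in `SiegelZeroDichotomyChowlaStep1.lean` (`TaoTeravainen2021_prop42_k0_of_prop35`) to
Proposition 3.5, (3.13)–(3.14) (`TaoTeravainen2021_eq313`, `TaoTeravainen2021_eq314` of
`Literature/NumberTheory/LFunctions/SiegelZeroExceptionalPrimes.lean`), both now proved in the tree
(`SiegelZeroExceptionalPrimesProofs.lean`, `SiegelZeroExceptionalPrimesSecond.lean`). This file
records the discharge. [cite: TaoTeravainen2021, Proposition 4.2 and Proposition 3.5]
-/

namespace Literature.Barriers.Parity

open Literature.NumberTheory.LFunctions.SiegelZero (TaoTeravainen2021_eq313_holds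
  TaoTeravainen2021_eq314_holds)

/-- **Tao–Teräväinen 2022, Proposition 4.2 at `k = 0` — PROVED** (step (i) of the main argument,
from Proposition 3.5 via Corollary 3.6, Lemma 4.1 and the sieve bound Lemma 3.2).
[cite: TaoTeravainen2021, Proposition 4.2] -/
theorem TaoTeravainen2021_prop42_k0_holds : TaoTeravainen2021_prop42_k0 :=
  TaoTeravainen2021_prop42_k0_of_prop35 TaoTeravainen2021_eq313_holds TaoTeravainen2021_eq314_holds

end Literature.Barriers.Parity
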